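import Summits.CriticalPhenomena.PercolationContinuityZ3.Theorems.PercNearOneGluingNoHeavyLowerTailThreePointPiecesStars
import HarnessLib

/-!
# The quartic isolation law `(Q4)` `P(a|b|c)⁴ ≤ P(c iso)·P(b iso)²·P(a iso)²` on parallel compositions of `(K)`-pieces

Support file for crux `stmt-CriticalPhenomena-4575` (`NoHeavyLowerTail`), seat `prim-l12-p1` gen 21
(`--supports stmt-CriticalPhenomena-4575`); continuation of the `…ThreePointPieces*.lean` chain of gen 20.
Memo `run/shared/lean/prim/prim-l12/FROM-prim-l12-p1-g21-*.md`.

Isolation coordinates of three terminals `a b c` of a finite weighted graph: `Q = P(a|b|c)`, `A = P(c ↮ {a,b})`,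
`B = P(b ↮ {a,c})`, `C = P(a ↮ {b,c})`.  They are MULTIPLICATIVE under parallel composition at `{a,b,c}`
(`ThreePointPieces.real_isoP`, `real_sepP`), so every inequality between `Q, A, B, C` that is to hold on all finite weighted
graphs must survive arbitrary products; the three-point variance row `(3PT)` `2Q − A ≤ (B + C − Q)²` does not (it is refuted
for all large `n` by parallel powers, `…ThreePointVarianceRefutationGadget`), and its tangent half-space at the sparse corner is
the MONOMIAL law

  `(Q4)`  `Q⁴ ≤ A · B² · C²`,  i.e.  `P(a|b|c)⁴ ≤ P(c ↮ {a,b}) · P(b ↮ {a,c})² · P(a ↮ {b,c})²`,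

which is product-closed by construction.  This file proves `(Q4)` on the whole class of gen 20's Theorem P: every parallel
composition at `{a,b,c}` of pieces satisfying the isolation criterion `(K)` (`Qᵢ³ ≤ AᵢBᵢ²Cᵢ`, `Qᵢ³ ≤ AᵢBᵢCᵢ²` suffice), in
particular of star-shaped pieces and series pieces (`isoQuartic_of_stars_and_series`, `isoQuartic_of_hubs_and_series`).
The algebra is `isoQuartic_of_isoK`: `Q³ ≤ AB²C`, `Q³ ≤ ABC²`, `0 ≤ Q ≤ B, C` give `Q⁸ ≤ A²B³C³·Q² ≤ A²B⁴C⁴`.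
Whether `(Q4)` holds on ALL finite weighted graphs is open (memo: numerically `ln(ABC/Q²) ≥ λ·(ln Q/B + ln Q/C)` holds with
`λ ≈ 0.2` on everything of order `≤ 8`, iterated Poisson fans push the needed `λ` to `1/2`, and `(Q4)` is `λ = 1`).
-/

namespace Summit.CriticalPhenomena.PercolationContinuityZ3.Theorems.ThreePointIsoQuartic

open MeasureTheory Set
open Literature.Probability.Percolation Literature.Probability.LatticeModels
open Summit.CriticalPhenomena.PercolationContinuityZ3.Theorems.ThreePointHubEvents (tClosed real_tClosed real_tClosed_inter)
open Summit.CriticalPhenomena.PercolationContinuityZ3.Theorems.ThreePointPieces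

variable {V : Type*} [Fintype V] [DecidableEq V] {ι : Type*} [Fintype ι] [DecidableEq ι]

/-! ## Algebra: two of the three `(K)` inequalities imply `(Q4)` -/

/-- **`(K) ⟹ (Q4)`**: if `0 ≤ Q ≤ B`, `Q ≤ C`, `0 ≤ A` and `Q³ ≤ A·B²·C`, `Q³ ≤ A·B·C²`, then `Q⁴ ≤ A·B²·C²`
(multiply the two cubic inequalities and use `Q² ≤ BC`). [this work] -/
theorem isoQuartic_of_isoK {Q A B C : ℝ} (hQ : 0 ≤ Q) (hA : 0 ≤ A) (hQB : Q ≤ B) (hQC : Q ≤ C)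
    (hKB : Q ^ 3 ≤ A * B ^ 2 * C) (hKC : Q ^ 3 ≤ A * B * C ^ 2) : Q ^ 4 ≤ A * B ^ 2 * C ^ 2 := by
  have hB : 0 ≤ B := hQ.trans hQB
  have hC : 0 ≤ C := hQ.trans hQC
  have h6 : Q ^ 3 * Q ^ 3 ≤ (A * B ^ 2 * C) * (A * B * C ^ 2) :=
    mul_le_mul hKB hKC (pow_nonneg hQ 3) (mul_nonneg (mul_nonneg hA (sq_nonneg B)) hC)
  have h2 : Q * Q ≤ B * C := mul_le_mul hQB hQC hQ hB
  have h8 : (Q ^ 4) ^ 2 ≤ (A * B ^ 2 * C ^ 2) ^ 2 := by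
    have e1 : (Q ^ 4) ^ 2 = (Q ^ 3 * Q ^ 3) * (Q * Q) := by ring
    have e2 : (A * B ^ 2 * C ^ 2) ^ 2 = ((A * B ^ 2 * C) * (A * B * C ^ 2)) * (B * C) := by ring
    rw [e1, e2]
    exact mul_le_mul h6 h2 (mul_nonneg hQ hQ)
      (mul_nonneg (mul_nonneg (mul_nonneg hA (sq_nonneg B)) hC) (mul_nonneg (mul_nonneg hA hB) (sq_nonneg C)))
  have hR : 0 ≤ A * B ^ 2 * C ^ 2 := mul_nonneg (mul_nonneg hA (sq_nonneg B)) (sq_nonneg C)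
  exact (pow_le_pow_iff_left₀ (pow_nonneg hQ 4) hR two_ne_zero).1 h8

/-! ## `(K)` for the whole law from `(K)` per piece, and `(Q4)` -/

/-- **The quartic isolation law `(Q4)` for parallel compositions of `(K)`-pieces.**  Let `part : V → ι` label the vertices of a
finite weighted graph with pairwise distinct terminals `a b c`, non-terminals with different labels never joined (weight `0`).
If every piece `i` satisfies two of the three `(K)` inequalities for its cylinder probabilities `Qᵢ = P(a|b|c inside i)`,
`Aᵢ = P(c isolated inside i)`, `Bᵢ = P(b isolated inside i)`, `Cᵢ = P(a isolated inside i)` — `Qᵢ³ ≤ AᵢBᵢ²Cᵢ` and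
`Qᵢ³ ≤ AᵢBᵢCᵢ²` — then `P(a|b|c)⁴ ≤ P(c ↮ {a,b}) · P(b ↮ {a,c})² · P(a ↮ {b,c})²`. [this work] -/
theorem isoQuartic_of_pieces (w : Sym2 V → unitInterval) {a b c : V} (hab : a ≠ b) (hac : a ≠ c) (hbc : b ≠ c)
    (part : V → ι) (hw : ∀ u v : V, u ∉ terms a b c → v ∉ terms a b c → part u ≠ part v → (w s(u, v) : ℝ) = 0)
    (hKB : ∀ i, (prodBernoulli w).real (isoPiece (piecePairs a b c part i) a b c ∩ isoPiece (piecePairs a b c part i) b a c) ^ 3 ≤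
      (prodBernoulli w).real (isoPiece (piecePairs a b c part i) c a b) *
        (prodBernoulli w).real (isoPiece (piecePairs a b c part i) b a c) ^ 2 * (prodBernoulli w).real (isoPiece (piecePairs a b c part i) a b c))
    (hKC : ∀ i, (prodBernoulli w).real (isoPiece (piecePairs a b c part i) a b c ∩ isoPiece (piecePairs a b c part i) b a c) ^ 3 ≤
      (prodBernoulli w).real (isoPiece (piecePairs a b c part i) c a b) *
        (prodBernoulli w).real (isoPiece (piecePairs a b c part i) b a c) * (prodBernoulli w).real (isoPiece (piecePairs a b c part i) a b c) ^ 2) :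
    (prodBernoulli w).real ((openConn a b)ᶜ ∩ (openConn a c)ᶜ ∩ (openConn b c)ᶜ) ^ 4 ≤
      (prodBernoulli w).real ((openConn a c)ᶜ ∩ (openConn b c)ᶜ) *
        (prodBernoulli w).real ((openConn a b)ᶜ ∩ (openConn b c)ᶜ) ^ 2 *
          (prodBernoulli w).real ((openConn a b)ᶜ ∩ (openConn a c)ᶜ) ^ 2 := by
  have hN : (prodBernoulli w).real (badP a b c part) = 0 := real_badP w a b c part hw
  set μ := prodBernoulli w with hμ
  set IA : Set (BondConfig V) := (openConn a b)ᶜ ∩ (openConn a c)ᶜ with hIA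
  set IB : Set (BondConfig V) := (openConn a b)ᶜ ∩ (openConn b c)ᶜ with hIB
  set IC : Set (BondConfig V) := (openConn a c)ᶜ ∩ (openConn b c)ᶜ with hIC
  have hsep : (openConn a b)ᶜ ∩ (openConn a c)ᶜ ∩ (openConn b c)ᶜ = IA ∩ IB := by
    ext ω
    simp only [hIA, hIB, mem_inter_iff, mem_compl_iff]
    tauto
  rw [hsep]
  -- product structure of `Q, A, B, C`
  set F : ι → Finset (Sym2 V) := fun i => piecePairs a b c part i with hF
  set PQ : ℝ := ∏ i ∈ (Finset.univ : Finset ι), μ.real (isoPiece (F i) a b c ∩ isoPiece (F i) b a c) with hPQ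
  set PA : ℝ := ∏ i ∈ (Finset.univ : Finset ι), μ.real (isoPiece (F i) c a b) with hPA
  set PB : ℝ := ∏ i ∈ (Finset.univ : Finset ι), μ.real (isoPiece (F i) b a c) with hPB
  set PC : ℝ := ∏ i ∈ (Finset.univ : Finset ι), μ.real (isoPiece (F i) a b c) with hPC
  set pab : ℝ := (w s(a, b) : ℝ)
  set pac : ℝ := (w s(a, c) : ℝ)
  set pbc : ℝ := (w s(b, c) : ℝ)
  have hpab : 0 ≤ 1 - pab := sub_nonneg.2 (unitInterval.le_one _)
  have hpac : 0 ≤ 1 - pac := sub_nonneg.2 (unitInterval.le_one _)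
  have hpbc : 0 ≤ 1 - pbc := sub_nonneg.2 (unitInterval.le_one _)
  have hpab1 : 1 - pab ≤ 1 := sub_le_self _ (unitInterval.nonneg _)
  have hpac1 : 1 - pac ≤ 1 := sub_le_self _ (unitInterval.nonneg _)
  have hpbc1 : 1 - pbc ≤ 1 := sub_le_self _ (unitInterval.nonneg _)
  have eQ : μ.real (IA ∩ IB) = (1 - pab) * (1 - pac) * (1 - pbc) * PQ := by
    rw [hIA, hIB, hμ, real_sepP' w part hab hac hbc hN, real_sepP, real_tClosed_inter w hab hac hbc]
  have eA : μ.real IC = (1 - pac) * (1 - pbc) * PA := by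
    rw [hIC, hμ, real_isoPc w part hac hbc hN, real_isoP w a b c part (mem_terms.2 (Or.inr (Or.inr rfl))) (mem_terms.2 (Or.inl rfl)) (mem_terms.2 (Or.inr (Or.inl rfl))),
      real_tClosed w hab, Sym2.eq_swap (a := c) (b := a), Sym2.eq_swap (a := c) (b := b)]
  have eB : μ.real IB = (1 - pab) * (1 - pbc) * PB := by
    rw [hIB, hμ, real_isoPb w part hab hbc hN, real_isoP w a b c part (mem_terms.2 (Or.inr (Or.inl rfl))) (mem_terms.2 (Or.inl rfl)) (mem_terms.2 (Or.inr (Or.inr rfl))),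
      real_tClosed w hac, Sym2.eq_swap (a := b) (b := a)]
  have eC : μ.real IA = (1 - pab) * (1 - pac) * PC := by
    rw [hIA, hμ, real_isoPa w part hab hac hN, real_isoP w a b c part (mem_terms.2 (Or.inl rfl)) (mem_terms.2 (Or.inr (Or.inl rfl))) (mem_terms.2 (Or.inr (Or.inr rfl))),
      real_tClosed w hbc]
  have hQnn : ∀ i ∈ (Finset.univ : Finset ι), 0 ≤ μ.real (isoPiece (F i) a b c ∩ isoPiece (F i) b a c) :=
    fun _ _ => measureReal_nonneg
  have hPQnn : 0 ≤ PQ := Finset.prod_nonneg hQnn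
  have hKB' : PQ ^ 3 ≤ PB ^ 2 * PA * PC :=
    ThreePointIsoProduct.isoK_prod Finset.univ _ _ _ _ hQnn fun i _ => (hKB i).trans_eq (by ring)
  have hKC' : PQ ^ 3 ≤ PC ^ 2 * PA * PB :=
    ThreePointIsoProduct.isoK_prod Finset.univ _ _ _ _ hQnn fun i _ => (hKC i).trans_eq (by ring)
  have hTB := ThreePointHubGraphs.tri_isoK (q := 1 - pab) (r := 1 - pbc) hpac1 hpab hpbc
  have hTC := ThreePointHubGraphs.tri_isoK (q := 1 - pab) (r := 1 - pac) hpbc1 hpab hpac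
  -- `(K)` for the whole law (the two inequalities needed)
  have hB3 : μ.real (IA ∩ IB) ^ 3 ≤ μ.real IC * μ.real IB ^ 2 * μ.real IA := by
    rw [eQ, eA, eB, eC]
    calc ((1 - pab) * (1 - pac) * (1 - pbc) * PQ) ^ 3 = ((1 - pac) * (1 - pab) * (1 - pbc)) ^ 3 * PQ ^ 3 := by ring
      _ ≤ ((1 - pab) * (1 - pbc)) ^ 2 * ((1 - pac) * (1 - pbc)) * ((1 - pac) * (1 - pab)) * (PB ^ 2 * PA * PC) :=
          mul_le_mul hTB hKB' (pow_nonneg hPQnn 3) (mul_nonneg (mul_nonneg (sq_nonneg _) (mul_nonneg hpac hpbc)) (mul_nonneg hpac hpab))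
      _ = _ := by ring
  have hC3 : μ.real (IA ∩ IB) ^ 3 ≤ μ.real IC * μ.real IB * μ.real IA ^ 2 := by
    rw [eQ, eA, eB, eC]
    calc ((1 - pab) * (1 - pac) * (1 - pbc) * PQ) ^ 3 = ((1 - pbc) * (1 - pab) * (1 - pac)) ^ 3 * PQ ^ 3 := by ring
      _ ≤ ((1 - pab) * (1 - pac)) ^ 2 * ((1 - pbc) * (1 - pac)) * ((1 - pbc) * (1 - pab)) * (PC ^ 2 * PA * PB) :=
          mul_le_mul hTC hKC' (pow_nonneg hPQnn 3) (mul_nonneg (mul_nonneg (sq_nonneg _) (mul_nonneg hpbc hpac)) (mul_nonneg hpbc hpab))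
      _ = _ := by ring
  exact isoQuartic_of_isoK measureReal_nonneg measureReal_nonneg
    (measureReal_mono fun ω ⟨_, h⟩ => h) (measureReal_mono fun ω ⟨h, _⟩ => h) hB3 hC3

/-! ## Classes: star-shaped pieces and series pieces -/

/-- **`(Q4)` for every parallel composition of star-shaped pieces and series pieces, all weights** (the class of gen 20's
Theorem P, hypotheses verbatim as in `ThreePointPieces.threePointVariance_of_stars_and_series`):
`P(a|b|c)⁴ ≤ P(c ↮ {a,b}) · P(b ↮ {a,c})² · P(a ↮ {b,c})²`. [this work] -/
theorem isoQuartic_of_stars_and_series (w : Sym2 V → unitInterval) {a b c : V} (hab : a ≠ b) (hac : a ≠ c)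
    (hbc : b ≠ c) (part : V → ι) (hw : ∀ u v : V, u ∉ terms a b c → v ∉ terms a b c → part u ≠ part v → (w s(u, v) : ℝ) = 0)
    (hkind : ∀ i, (∃ (h : V) (ρ : V → V), h ∉ terms a b c ∧ part h = i ∧
        ∀ u v : V, s(u, v) ∈ piecePairs a b c part i → u ≠ h → v ≠ h →
          (¬ ∃ x, x ∈ terms a b c ∧ (u = x ∨ (u ∉ terms a b c ∧ part u = i ∧ ρ u = x)) ∧
            (v = x ∨ (v ∉ terms a b c ∧ part v = i ∧ ρ v = x))) → (w s(u, v) : ℝ) = 0) ∨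
      ∃ X : Finset V,
        (∀ u v : V, (u = a ∨ (u ∉ terms a b c ∧ part u = i ∧ u ∈ X)) → (v = b ∨ (v ∉ terms a b c ∧ part v = i ∧ v ∉ X)) →
          ((u ∉ terms a b c ∧ part u = i ∧ u ∈ X) ∨ (v ∉ terms a b c ∧ part v = i ∧ v ∉ X)) → (w s(u, v) : ℝ) = 0) ∨
        (∀ u v : V, (u = b ∨ (u ∉ terms a b c ∧ part u = i ∧ u ∈ X)) → (v = c ∨ (v ∉ terms a b c ∧ part v = i ∧ v ∉ X)) →
          ((u ∉ terms a b c ∧ part u = i ∧ u ∈ X) ∨ (v ∉ terms a b c ∧ part v = i ∧ v ∉ X)) → (w s(u, v) : ℝ) = 0) ∨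
        (∀ u v : V, (u = a ∨ (u ∉ terms a b c ∧ part u = i ∧ u ∈ X)) → (v = c ∨ (v ∉ terms a b c ∧ part v = i ∧ v ∉ X)) →
          ((u ∉ terms a b c ∧ part u = i ∧ u ∈ X) ∨ (v ∉ terms a b c ∧ part v = i ∧ v ∉ X)) → (w s(u, v) : ℝ) = 0)) :
    (prodBernoulli w).real ((openConn a b)ᶜ ∩ (openConn a c)ᶜ ∩ (openConn b c)ᶜ) ^ 4 ≤
      (prodBernoulli w).real ((openConn a c)ᶜ ∩ (openConn b c)ᶜ) *
        (prodBernoulli w).real ((openConn a b)ᶜ ∩ (openConn b c)ᶜ) ^ 2 *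
          (prodBernoulli w).real ((openConn a b)ᶜ ∩ (openConn a c)ᶜ) ^ 2 := by
  have hK : ∀ i, let F := piecePairs a b c part i
      (prodBernoulli w).real (isoPiece F a b c ∩ isoPiece F b a c) ^ 3 ≤
          (prodBernoulli w).real (isoPiece F c a b) ^ 2 * (prodBernoulli w).real (isoPiece F b a c) *
            (prodBernoulli w).real (isoPiece F a b c) ∧
        (prodBernoulli w).real (isoPiece F a b c ∩ isoPiece F b a c) ^ 3 ≤
          (prodBernoulli w).real (isoPiece F c a b) * (prodBernoulli w).real (isoPiece F b a c) ^ 2 *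
            (prodBernoulli w).real (isoPiece F a b c) ∧
        (prodBernoulli w).real (isoPiece F a b c ∩ isoPiece F b a c) ^ 3 ≤
          (prodBernoulli w).real (isoPiece F c a b) * (prodBernoulli w).real (isoPiece F b a c) *
            (prodBernoulli w).real (isoPiece F a b c) ^ 2 := by
    intro i
    rcases hkind i with ⟨h, ρ, hh, hhi, hs⟩ | ⟨X, hX⟩
    · exact isoK_star w (part := part) (i := i) (h := h) (ρ := ρ) hab hac hbc hh hhi hs
    · exact isoK_series w part i hab hac hbc X hX
  exact isoQuartic_of_pieces w hab hac hbc part hw (fun i => (hK i).2.1) (fun i => (hK i).2.2)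

/-- **`(Q4)` for every parallel composition of single hubs and series pieces, all weights** (hypotheses verbatim as in
`ThreePointPieces.threePointVariance_of_hubs_and_series`; contains every hub graph of Theorem H):
`P(a|b|c)⁴ ≤ P(c ↮ {a,b}) · P(b ↮ {a,c})² · P(a ↮ {b,c})²`. [this work] -/
theorem isoQuartic_of_hubs_and_series (w : Sym2 V → unitInterval) {a b c : V} (hab : a ≠ b) (hac : a ≠ c) (hbc : b ≠ c)
    (part : V → ι) (hw : ∀ u v : V, u ∉ terms a b c → v ∉ terms a b c → part u ≠ part v → (w s(u, v) : ℝ) = 0)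
    (hkind : ∀ i, (∃ h, h ∉ terms a b c ∧ part h = i ∧ ∀ v, v ∉ terms a b c → part v = i → v = h) ∨
      ∃ X : Finset V,
        (∀ u v : V, (u = a ∨ (u ∉ terms a b c ∧ part u = i ∧ u ∈ X)) → (v = b ∨ (v ∉ terms a b c ∧ part v = i ∧ v ∉ X)) →
          ((u ∉ terms a b c ∧ part u = i ∧ u ∈ X) ∨ (v ∉ terms a b c ∧ part v = i ∧ v ∉ X)) → (w s(u, v) : ℝ) = 0) ∨
        (∀ u v : V, (u = b ∨ (u ∉ terms a b c ∧ part u = i ∧ u ∈ X)) → (v = c ∨ (v ∉ terms a b c ∧ part v = i ∧ v ∉ X)) →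
          ((u ∉ terms a b c ∧ part u = i ∧ u ∈ X) ∨ (v ∉ terms a b c ∧ part v = i ∧ v ∉ X)) → (w s(u, v) : ℝ) = 0) ∨
        (∀ u v : V, (u = a ∨ (u ∉ terms a b c ∧ part u = i ∧ u ∈ X)) → (v = c ∨ (v ∉ terms a b c ∧ part v = i ∧ v ∉ X)) →
          ((u ∉ terms a b c ∧ part u = i ∧ u ∈ X) ∨ (v ∉ terms a b c ∧ part v = i ∧ v ∉ X)) → (w s(u, v) : ℝ) = 0)) :
    (prodBernoulli w).real ((openConn a b)ᶜ ∩ (openConn a c)ᶜ ∩ (openConn b c)ᶜ) ^ 4 ≤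
      (prodBernoulli w).real ((openConn a c)ᶜ ∩ (openConn b c)ᶜ) *
        (prodBernoulli w).real ((openConn a b)ᶜ ∩ (openConn b c)ᶜ) ^ 2 *
          (prodBernoulli w).real ((openConn a b)ᶜ ∩ (openConn a c)ᶜ) ^ 2 := by
  have hK : ∀ i, let F := piecePairs a b c part i
      (prodBernoulli w).real (isoPiece F a b c ∩ isoPiece F b a c) ^ 3 ≤
          (prodBernoulli w).real (isoPiece F c a b) ^ 2 * (prodBernoulli w).real (isoPiece F b a c) *
            (prodBernoulli w).real (isoPiece F a b c) ∧
        (prodBernoulli w).real (isoPiece F a b c ∩ isoPiece F b a c) ^ 3 ≤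
          (prodBernoulli w).real (isoPiece F c a b) * (prodBernoulli w).real (isoPiece F b a c) ^ 2 *
            (prodBernoulli w).real (isoPiece F a b c) ∧
        (prodBernoulli w).real (isoPiece F a b c ∩ isoPiece F b a c) ^ 3 ≤
          (prodBernoulli w).real (isoPiece F c a b) * (prodBernoulli w).real (isoPiece F b a c) *
            (prodBernoulli w).real (isoPiece F a b c) ^ 2 := by
    intro i
    rcases hkind i with ⟨h, hh, hhi, hi⟩ | ⟨X, hX⟩
    · exact isoK_hub w part hab hac hbc hh hhi hi
    · exact isoK_series w part i hab hac hbc X hX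
  exact isoQuartic_of_pieces w hab hac hbc part hw (fun i => (hK i).2.1) (fun i => (hK i).2.2)


/-! ## Appendix (gen 21, second landing): the SEXTIC isolation law `(Q6)` `Q⁶ ≤ A²·B³·C³`

`(K)` gives more than `(Q4)`: the two cubic inequalities `Q³ ≤ AB²C`, `Q³ ≤ ABC²` multiply to the sextic law
`Q⁶ ≤ A²B³C³`, i.e. `ln(ABC/Q²) ≥ ½(ln Q/B + ln Q/C)` — exponent `λ = 1/2` in the family `A(BC)^{1+λ} ≥ Q^{2+2λ}`
(`(Q4)` is `λ = 1`).  `λ = 1/2` is the SHARP exponent if the law holds on all finite weighted graphs: iterated Poisson fans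
(memo `FROM-prim-l12-p1-g21-*.md`) realise every `λ < 1/2`-violation.  Here: `(Q6)` on the class of Theorem P. -/

/-- **`(K) ⟹ (Q6)`**: if `0 ≤ Q`, `Q³ ≤ A·B²·C` and `Q³ ≤ A·B·C²` then `Q⁶ ≤ A²·B³·C³`. [this work] -/
theorem isoSextic_of_isoK {Q A B C : ℝ} (hQ : 0 ≤ Q) (hKB : Q ^ 3 ≤ A * B ^ 2 * C) (hKC : Q ^ 3 ≤ A * B * C ^ 2) :
    Q ^ 6 ≤ A ^ 2 * B ^ 3 * C ^ 3 := by
  have h := mul_le_mul hKB hKC (pow_nonneg hQ 3) ((pow_nonneg hQ 3).trans hKB)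
  calc Q ^ 6 = Q ^ 3 * Q ^ 3 := by ring
    _ ≤ (A * B ^ 2 * C) * (A * B * C ^ 2) := h
    _ = A ^ 2 * B ^ 3 * C ^ 3 := by ring

/-- **Two components of `(K)` for the whole law from the same two components per piece.**  Hypotheses as in
`isoQuartic_of_pieces`; conclusion: `P(a|b|c)³ ≤ P(c iso)·P(b iso)²·P(a iso)` and `P(a|b|c)³ ≤ P(c iso)·P(b iso)·P(a iso)²`
(isolation from the other two terminals). [this work] -/
theorem isoKBC_of_pieces (w : Sym2 V → unitInterval) {a b c : V} (hab : a ≠ b) (hac : a ≠ c) (hbc : b ≠ c)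
    (part : V → ι) (hw : ∀ u v : V, u ∉ terms a b c → v ∉ terms a b c → part u ≠ part v → (w s(u, v) : ℝ) = 0)
    (hKB : ∀ i, (prodBernoulli w).real (isoPiece (piecePairs a b c part i) a b c ∩ isoPiece (piecePairs a b c part i) b a c) ^ 3 ≤
      (prodBernoulli w).real (isoPiece (piecePairs a b c part i) c a b) *
        (prodBernoulli w).real (isoPiece (piecePairs a b c part i) b a c) ^ 2 * (prodBernoulli w).real (isoPiece (piecePairs a b c part i) a b c))
    (hKC : ∀ i, (prodBernoulli w).real (isoPiece (piecePairs a b c part i) a b c ∩ isoPiece (piecePairs a b c part i) b a c) ^ 3 ≤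
      (prodBernoulli w).real (isoPiece (piecePairs a b c part i) c a b) *
        (prodBernoulli w).real (isoPiece (piecePairs a b c part i) b a c) * (prodBernoulli w).real (isoPiece (piecePairs a b c part i) a b c) ^ 2) :
    (prodBernoulli w).real ((openConn a b)ᶜ ∩ (openConn a c)ᶜ ∩ (openConn b c)ᶜ) ^ 3 ≤
        (prodBernoulli w).real ((openConn a c)ᶜ ∩ (openConn b c)ᶜ) *
          (prodBernoulli w).real ((openConn a b)ᶜ ∩ (openConn b c)ᶜ) ^ 2 *
            (prodBernoulli w).real ((openConn a b)ᶜ ∩ (openConn a c)ᶜ) ∧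
      (prodBernoulli w).real ((openConn a b)ᶜ ∩ (openConn a c)ᶜ ∩ (openConn b c)ᶜ) ^ 3 ≤
        (prodBernoulli w).real ((openConn a c)ᶜ ∩ (openConn b c)ᶜ) *
          (prodBernoulli w).real ((openConn a b)ᶜ ∩ (openConn b c)ᶜ) *
            (prodBernoulli w).real ((openConn a b)ᶜ ∩ (openConn a c)ᶜ) ^ 2 := by
  have hN : (prodBernoulli w).real (badP a b c part) = 0 := real_badP w a b c part hw
  set μ := prodBernoulli w with hμ
  set IA : Set (BondConfig V) := (openConn a b)ᶜ ∩ (openConn a c)ᶜ with hIA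
  set IB : Set (BondConfig V) := (openConn a b)ᶜ ∩ (openConn b c)ᶜ with hIB
  set IC : Set (BondConfig V) := (openConn a c)ᶜ ∩ (openConn b c)ᶜ with hIC
  have hsep : (openConn a b)ᶜ ∩ (openConn a c)ᶜ ∩ (openConn b c)ᶜ = IA ∩ IB := by
    ext ω
    simp only [hIA, hIB, mem_inter_iff, mem_compl_iff]
    tauto
  rw [hsep]
  set F : ι → Finset (Sym2 V) := fun i => piecePairs a b c part i with hF
  set PQ : ℝ := ∏ i ∈ (Finset.univ : Finset ι), μ.real (isoPiece (F i) a b c ∩ isoPiece (F i) b a c) with hPQ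
  set PA : ℝ := ∏ i ∈ (Finset.univ : Finset ι), μ.real (isoPiece (F i) c a b) with hPA
  set PB : ℝ := ∏ i ∈ (Finset.univ : Finset ι), μ.real (isoPiece (F i) b a c) with hPB
  set PC : ℝ := ∏ i ∈ (Finset.univ : Finset ι), μ.real (isoPiece (F i) a b c) with hPC
  set pab : ℝ := (w s(a, b) : ℝ)
  set pac : ℝ := (w s(a, c) : ℝ)
  set pbc : ℝ := (w s(b, c) : ℝ)
  have hpab : 0 ≤ 1 - pab := sub_nonneg.2 (unitInterval.le_one _)
  have hpac : 0 ≤ 1 - pac := sub_nonneg.2 (unitInterval.le_one _)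
  have hpbc : 0 ≤ 1 - pbc := sub_nonneg.2 (unitInterval.le_one _)
  have hpac1 : 1 - pac ≤ 1 := sub_le_self _ (unitInterval.nonneg _)
  have hpbc1 : 1 - pbc ≤ 1 := sub_le_self _ (unitInterval.nonneg _)
  have eQ : μ.real (IA ∩ IB) = (1 - pab) * (1 - pac) * (1 - pbc) * PQ := by
    rw [hIA, hIB, hμ, real_sepP' w part hab hac hbc hN, real_sepP, real_tClosed_inter w hab hac hbc]
  have eA : μ.real IC = (1 - pac) * (1 - pbc) * PA := by
    rw [hIC, hμ, real_isoPc w part hac hbc hN, real_isoP w a b c part (mem_terms.2 (Or.inr (Or.inr rfl))) (mem_terms.2 (Or.inl rfl)) (mem_terms.2 (Or.inr (Or.inl rfl))),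
      real_tClosed w hab, Sym2.eq_swap (a := c) (b := a), Sym2.eq_swap (a := c) (b := b)]
  have eB : μ.real IB = (1 - pab) * (1 - pbc) * PB := by
    rw [hIB, hμ, real_isoPb w part hab hbc hN, real_isoP w a b c part (mem_terms.2 (Or.inr (Or.inl rfl))) (mem_terms.2 (Or.inl rfl)) (mem_terms.2 (Or.inr (Or.inr rfl))),
      real_tClosed w hac, Sym2.eq_swap (a := b) (b := a)]
  have eC : μ.real IA = (1 - pab) * (1 - pac) * PC := by
    rw [hIA, hμ, real_isoPa w part hab hac hN, real_isoP w a b c part (mem_terms.2 (Or.inl rfl)) (mem_terms.2 (Or.inr (Or.inl rfl))) (mem_terms.2 (Or.inr (Or.inr rfl))),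
      real_tClosed w hbc]
  have hQnn : ∀ i ∈ (Finset.univ : Finset ι), 0 ≤ μ.real (isoPiece (F i) a b c ∩ isoPiece (F i) b a c) :=
    fun _ _ => measureReal_nonneg
  have hPQnn : 0 ≤ PQ := Finset.prod_nonneg hQnn
  have hKB' : PQ ^ 3 ≤ PB ^ 2 * PA * PC :=
    ThreePointIsoProduct.isoK_prod Finset.univ _ _ _ _ hQnn fun i _ => (hKB i).trans_eq (by ring)
  have hKC' : PQ ^ 3 ≤ PC ^ 2 * PA * PB :=
    ThreePointIsoProduct.isoK_prod Finset.univ _ _ _ _ hQnn fun i _ => (hKC i).trans_eq (by ring)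
  have hTB := ThreePointHubGraphs.tri_isoK (q := 1 - pab) (r := 1 - pbc) hpac1 hpab hpbc
  have hTC := ThreePointHubGraphs.tri_isoK (q := 1 - pab) (r := 1 - pac) hpbc1 hpab hpac
  constructor
  · rw [eQ, eA, eB, eC]
    calc ((1 - pab) * (1 - pac) * (1 - pbc) * PQ) ^ 3 = ((1 - pac) * (1 - pab) * (1 - pbc)) ^ 3 * PQ ^ 3 := by ring
      _ ≤ ((1 - pab) * (1 - pbc)) ^ 2 * ((1 - pac) * (1 - pbc)) * ((1 - pac) * (1 - pab)) * (PB ^ 2 * PA * PC) :=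
          mul_le_mul hTB hKB' (pow_nonneg hPQnn 3) (mul_nonneg (mul_nonneg (sq_nonneg _) (mul_nonneg hpac hpbc)) (mul_nonneg hpac hpab))
      _ = _ := by ring
  · rw [eQ, eA, eB, eC]
    calc ((1 - pab) * (1 - pac) * (1 - pbc) * PQ) ^ 3 = ((1 - pbc) * (1 - pab) * (1 - pac)) ^ 3 * PQ ^ 3 := by ring
      _ ≤ ((1 - pab) * (1 - pac)) ^ 2 * ((1 - pbc) * (1 - pac)) * ((1 - pbc) * (1 - pab)) * (PC ^ 2 * PA * PB) :=
          mul_le_mul hTC hKC' (pow_nonneg hPQnn 3) (mul_nonneg (mul_nonneg (sq_nonneg _) (mul_nonneg hpbc hpac)) (mul_nonneg hpbc hpab))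
      _ = _ := by ring

/-- **The sextic isolation law `(Q6)` for parallel compositions of `(K)`-pieces**: hypotheses as in `isoQuartic_of_pieces`;
`P(a|b|c)⁶ ≤ P(c ↮ {a,b})² · P(b ↮ {a,c})³ · P(a ↮ {b,c})³`. [this work] -/
theorem isoSextic_of_pieces (w : Sym2 V → unitInterval) {a b c : V} (hab : a ≠ b) (hac : a ≠ c) (hbc : b ≠ c)
    (part : V → ι) (hw : ∀ u v : V, u ∉ terms a b c → v ∉ terms a b c → part u ≠ part v → (w s(u, v) : ℝ) = 0)
    (hKB : ∀ i, (prodBernoulli w).real (isoPiece (piecePairs a b c part i) a b c ∩ isoPiece (piecePairs a b c part i) b a c) ^ 3 ≤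
      (prodBernoulli w).real (isoPiece (piecePairs a b c part i) c a b) *
        (prodBernoulli w).real (isoPiece (piecePairs a b c part i) b a c) ^ 2 * (prodBernoulli w).real (isoPiece (piecePairs a b c part i) a b c))
    (hKC : ∀ i, (prodBernoulli w).real (isoPiece (piecePairs a b c part i) a b c ∩ isoPiece (piecePairs a b c part i) b a c) ^ 3 ≤
      (prodBernoulli w).real (isoPiece (piecePairs a b c part i) c a b) *
        (prodBernoulli w).real (isoPiece (piecePairs a b c part i) b a c) * (prodBernoulli w).real (isoPiece (piecePairs a b c part i) a b c) ^ 2) :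
    (prodBernoulli w).real ((openConn a b)ᶜ ∩ (openConn a c)ᶜ ∩ (openConn b c)ᶜ) ^ 6 ≤
      (prodBernoulli w).real ((openConn a c)ᶜ ∩ (openConn b c)ᶜ) ^ 2 *
        (prodBernoulli w).real ((openConn a b)ᶜ ∩ (openConn b c)ᶜ) ^ 3 *
          (prodBernoulli w).real ((openConn a b)ᶜ ∩ (openConn a c)ᶜ) ^ 3 := by
  obtain ⟨h1, h2⟩ := isoKBC_of_pieces w hab hac hbc part hw hKB hKC
  exact isoSextic_of_isoK measureReal_nonneg h1 h2

/-- **`(Q6)` for every parallel composition of star-shaped pieces and series pieces, all weights** (hypotheses verbatim as in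
`ThreePointPieces.threePointVariance_of_stars_and_series`):
`P(a|b|c)⁶ ≤ P(c ↮ {a,b})² · P(b ↮ {a,c})³ · P(a ↮ {b,c})³`. [this work] -/
theorem isoSextic_of_stars_and_series (w : Sym2 V → unitInterval) {a b c : V} (hab : a ≠ b) (hac : a ≠ c)
    (hbc : b ≠ c) (part : V → ι) (hw : ∀ u v : V, u ∉ terms a b c → v ∉ terms a b c → part u ≠ part v → (w s(u, v) : ℝ) = 0)
    (hkind : ∀ i, (∃ (h : V) (ρ : V → V), h ∉ terms a b c ∧ part h = i ∧
        ∀ u v : V, s(u, v) ∈ piecePairs a b c part i → u ≠ h → v ≠ h →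
          (¬ ∃ x, x ∈ terms a b c ∧ (u = x ∨ (u ∉ terms a b c ∧ part u = i ∧ ρ u = x)) ∧
            (v = x ∨ (v ∉ terms a b c ∧ part v = i ∧ ρ v = x))) → (w s(u, v) : ℝ) = 0) ∨
      ∃ X : Finset V,
        (∀ u v : V, (u = a ∨ (u ∉ terms a b c ∧ part u = i ∧ u ∈ X)) → (v = b ∨ (v ∉ terms a b c ∧ part v = i ∧ v ∉ X)) →
          ((u ∉ terms a b c ∧ part u = i ∧ u ∈ X) ∨ (v ∉ terms a b c ∧ part v = i ∧ v ∉ X)) → (w s(u, v) : ℝ) = 0) ∨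
        (∀ u v : V, (u = b ∨ (u ∉ terms a b c ∧ part u = i ∧ u ∈ X)) → (v = c ∨ (v ∉ terms a b c ∧ part v = i ∧ v ∉ X)) →
          ((u ∉ terms a b c ∧ part u = i ∧ u ∈ X) ∨ (v ∉ terms a b c ∧ part v = i ∧ v ∉ X)) → (w s(u, v) : ℝ) = 0) ∨
        (∀ u v : V, (u = a ∨ (u ∉ terms a b c ∧ part u = i ∧ u ∈ X)) → (v = c ∨ (v ∉ terms a b c ∧ part v = i ∧ v ∉ X)) →
          ((u ∉ terms a b c ∧ part u = i ∧ u ∈ X) ∨ (v ∉ terms a b c ∧ part v = i ∧ v ∉ X)) → (w s(u, v) : ℝ) = 0)) :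
    (prodBernoulli w).real ((openConn a b)ᶜ ∩ (openConn a c)ᶜ ∩ (openConn b c)ᶜ) ^ 6 ≤
      (prodBernoulli w).real ((openConn a c)ᶜ ∩ (openConn b c)ᶜ) ^ 2 *
        (prodBernoulli w).real ((openConn a b)ᶜ ∩ (openConn b c)ᶜ) ^ 3 *
          (prodBernoulli w).real ((openConn a b)ᶜ ∩ (openConn a c)ᶜ) ^ 3 := by
  have hK : ∀ i, let F := piecePairs a b c part i
      (prodBernoulli w).real (isoPiece F a b c ∩ isoPiece F b a c) ^ 3 ≤
          (prodBernoulli w).real (isoPiece F c a b) ^ 2 * (prodBernoulli w).real (isoPiece F b a c) *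
            (prodBernoulli w).real (isoPiece F a b c) ∧
        (prodBernoulli w).real (isoPiece F a b c ∩ isoPiece F b a c) ^ 3 ≤
          (prodBernoulli w).real (isoPiece F c a b) * (prodBernoulli w).real (isoPiece F b a c) ^ 2 *
            (prodBernoulli w).real (isoPiece F a b c) ∧
        (prodBernoulli w).real (isoPiece F a b c ∩ isoPiece F b a c) ^ 3 ≤
          (prodBernoulli w).real (isoPiece F c a b) * (prodBernoulli w).real (isoPiece F b a c) *
            (prodBernoulli w).real (isoPiece F a b c) ^ 2 := by
    intro i
    rcases hkind i with ⟨h, ρ, hh, hhi, hs⟩ | ⟨X, hX⟩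
    · exact isoK_star w (part := part) (i := i) (h := h) (ρ := ρ) hab hac hbc hh hhi hs
    · exact isoK_series w part i hab hac hbc X hX
  exact isoSextic_of_pieces w hab hac hbc part hw (fun i => (hK i).2.1) (fun i => (hK i).2.2)

end Summit.CriticalPhenomena.PercolationContinuityZ3.Theorems.ThreePointIsoQuartic
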